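import Literature.MathematicalPhysics.QuantumFieldTheory.Balaban1983to89.Node00.ContinuousTransportOnDomainOfRecord
import Literature.MathematicalPhysics.QuantumFieldTheory.Balaban1983to89.BlockAveragingPlaquetteBound

/-!
# NODE 00 (YM-PLAN Track A) — K0′ COMPONENT P7 `contT`, FILE 3: THE EXACT RESIDUE OF THE RECORD'S EVERYWHERE β-VERSION PROVISO OVER PRINT —
# far fields are FREE (averages of ε₀-small fields are not far: [Balaban1985Averaging] Prop 1, crude form, PROVED in the tree), so the everywhere field
# = print's ON-DOMAIN proviso + continuity on a neighbourhood of the compact TRANSITION ANNULUS {ε₀ ≤ max_p |V(∂p) − 1| ≤ C·ε₀}; the WINDOWED on-domain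
# proviso; the proviso in print's push-forward currency

Cell `pub-ymgap`, NODE 00, seat `pub-ymgap-node00-def-K0e` g2 (prover; K0′ row P7 of dag-lead's K0PRIME ledger, entry (3) «`contT` LOCATED-OPEN over-strength,
cure = def-T's Stage-13 record»).  [I] = [Balaban1987RG1] (CMP 109), [III] = [Balaban1988Convergent] (CMP 119), [B7] = [Balaban1985Averaging] (CMP 98).
Imports FILE 2 (`Node00.ContinuousTransportOnDomainOfRecord`: `TcOnOfRecord`, `Stage8Params.ContTOnDom`, `transportCOn`; through it FILE 1 `Node00.Record12ContT`:
`HasContVersionOn`, `HasContTransportOn`, `Stage8Params.HasContTransportAlongDom`) and ym3-torus' `BlockAveragingPlaquetteBound` (Prop 1 of [B7] in crude form for the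
(0.4) averaging with the printed `exp[mean log]` on `SU(N)`: `plaqSmall_blockAvg_expMeanLogSU`).  KNIT + BOOKKEEPING; count-neutral; NOTHING of Bałaban's asserted;
P7 is NOT discharged here in either form.

THE QUESTION THIS FILE ANSWERS.  FILE 1 located (L-K0e-1) that the record's field `Provisos₁₀.contT : HasContTransportAlong` (everywhere-continuous versions of
the kernel transforms `T_k(χ_k e^{−GF/g_k² + A_k})`, every torus, every real history, every `k < K`) exceeds print, which reads `A_{k+1}` on the small-field domain
`|∂V − 1| < ε₀` only ([I] p. 259).  WHERE EXACTLY does the excess live, and is any of it free?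
* FAR FIELDS ARE FREE (§3–§4).  The (0.19) density `ρ_k` carries the indicator `χ_k = 𝟙{|U(∂p) − 1| < ε₀ ∀p}`; by Prop 1 of [B7] in the tree's crude form, under the
  guard `(((d+2)L)²/4)·ε₀ < δ_N` every ε₀-small fine field averages to a `C·ε₀`-small coarse field, `C = L² + 6((d+2)L)²`; hence (push-forward reading `IsRT`
  tested against indicators) the kernel transform of `ρ_k` VANISHES a.e. on the open FAR REGION `{V | ∃ p, C·ε₀ < |V(∂p) − 1|}` — so it has a continuous version
  (`≡ 0`) there, for EVERY transport family feeding `A_k`, every history, with no proviso (`hasContTransportOn_far`).  This is [I] (0.17)'s small∕large split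
  read on the kernel transform.
* THE RESIDUE IS THE ANNULUS (§5).  Versions continuous on two OPEN sets glue (determinacy on the open overlap, product Haar charges open sets: §1
  `HasContVersionOn.union`), and `domAlt_{k+1} ∪ N ∪ far = univ` for ANY set `N` containing the closed annulus `{V ∉ domAlt_{k+1} | ∀ p, |V(∂p) − 1| ≤ C·ε₀}`;
  hence **`hasContTransportAt_of_dom_of_annulusNbhd`**: print's on-domain version + a version continuous on SOME open neighbourhood of the annulus ⇒ the
  record's everywhere field at that density; and at the θ-level, under the guard at `θ.ν`, **`hasContTransportAlong_iff_dom_and_annulus`**: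
  `HasContTransportAlong θ ↔ HasContTransportAlongDom θ Tc ∧ HasContTransportAlongAnnulus θ Tc`.  The second conjunct — continuity of the fibre integrals of
  (0.4) across the transition layer `ε₀ ≤ max_p|V(∂p) − 1| ≤ C·ε₀`, where `χ_{k+1} = 0` and print demands nothing — is the located excess, now a displayed
  predicate; it is a fibre-regularity statement about Bałaban's averaging, not a statement of [I] ∕ [III], and it is neither refuted nor proved here.
* THE GUARD IS A CONDITION ON THE NUMERICS (§3 `FarGuard`): `0 ≤ ε₀` and `(((d+2)L)²/4)·ε₀ < δ_N = min(1/3, π/N)` — print's «ε₀ sufficiently small»; it FAILS at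
  the displayed default `ε₀ = 1` of `Node00.numerics7OfRecord₁₂`, where the «small-field domain» straddles the branch switch of the tree's total (0.4) averaging
  and neither form of P7 speaks about print's objects (seat word WORD-ε₀, pub-ymgap INBOX 2026-08-26).
* THE WINDOW (§6).  FILE 2's `ContTOnDom` quantifies over ALL real histories; [III] (ii) (FILE 1 §4–§5, binder `hwin`) locates on-domain continuity only for
  histories in the coupling window.  `Stage8Params.ContTOnDomW` is the windowed proviso (guard `Step.InInterval θ.γ k g`, the predicate of `Provisos₁₂.bg`);
  N09's per-step triple and composition input follow from it at windowed histories (seat word WORD-W to the Stage-13 owner).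
* PRINT'S CURRENCY (§7).  For an integrable density and `k < K`: the everywhere proviso ⟺ «ρ has a CONTINUOUS renormalisation transform in the push-forward
  sense `Setup.IsRT`» ([B7] (10)), the on-domain one ⟺ «an integrable `IsRT` image continuous on the domain» — no kernel ∕ version vocabulary needed
  (`T4Spectator.ae_eq_of_isRT_of_isRT`).

HONEST FRAMING: definitions of four predicates∕sets + kernel-checked bookkeeping (Mathlib: uniqueness of continuous versions on open sets, `ae` calculus of
restrictions) + ONE crude estimate consumed by name (Prop 1 of [B7], tree theorem); nothing of Bałaban's asserted; `contT` NOT discharged, `ContTOnDom(W)` NOT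
discharged, the annulus proviso NEITHER proved NOR refuted; counts unmoved (typed 28∕28 · discharged 5∕28); one finite four-torus programme at fixed `ε = L^{−K}`
— NOT continuum ∕ ℝ⁴ ∕ OS ∕ mass gap ∕ Clay.  No `sorry`, no `axiom`, no `instance`, no `notation`.
-/

noncomputable section

open MeasureTheory Set
open scoped BigOperators

namespace Literature.MathematicalPhysics.QuantumFieldTheory.Balaban1983to89.Node00

open _root_.Topology
open T4Continuum (T4Family)
open B12Eq019ActionBody (integrand integrand_apply)
open T4AveragingDisintegration (transportK kernelTransport isRT_kernelTransport integrable_kernelTransport)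
open T4FiniteEpsInhabited (HaarAC)
open T4Spectator (ae_eq_of_isRT_of_isRT)
open B12ContinuousTransportInvarianceOn (isOpen_domAltOfRecord chiFixed7_eq_zero_of_not_mem continuous_dist1_SU continuous_plaqHol_SU
  hCompT_of_stepsOn_chiFixed7)
open B12NodeKnitContinuousTransport (integrable_integrand_TcOfRecord integrable_of_continuous)
open ExpMeanLog (deltaSU)

/-! ## §1. Gluing on-domain continuous versions (generic) -/

section Generic

variable {α : Type*} [TopologicalSpace α] [MeasurableSpace α] {μ : Measure α} {f : α → ℝ} {s t : Set α}

/-- Restriction of an on-domain continuous version to a smaller domain. [cite: Balaban1987RG1, (0.13) p.254 (bookkeeping)] -/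
theorem HasContVersionOn.mono (h : HasContVersionOn μ f s) (hts : t ⊆ s) : HasContVersionOn μ f t := by
  obtain ⟨g, hg, hae⟩ := h
  exact ⟨g, hg.mono hts, ae_restrict_of_ae_restrict_of_subset hts hae⟩

/-- A function a.e. zero on `s` has a version continuous on `s` (namely `0`). [cite: Balaban1987RG1, (0.13) p.254 (bookkeeping)] -/
theorem hasContVersionOn_of_ae_eq_zero (h : f =ᵐ[μ.restrict s] 0) : HasContVersionOn μ f s :=
  ⟨0, continuousOn_const, h.symm⟩

/-- **GLUING**: versions continuous on two OPEN sets give a version continuous on the union — on the open overlap the two versions agree at every point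
(determinacy: Mathlib `Measure.eqOn_open_of_ae_eq`, the measure charging non-empty open sets), so the piecewise function is continuous on the union.
[cite: Balaban1987RG1, (0.13) p.254 (bookkeeping)] -/
theorem HasContVersionOn.union [OpensMeasurableSpace α] [μ.IsOpenPosMeasure] (hs : IsOpen s) (ht : IsOpen t)
    (h₁ : HasContVersionOn μ f s) (h₂ : HasContVersionOn μ f t) : HasContVersionOn μ f (s ∪ t) := by
  classical
  obtain ⟨g₁, hg₁, hae₁⟩ := h₁
  obtain ⟨g₂, hg₂, hae₂⟩ := h₂
  -- on the open overlap the two versions agree pointwise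
  have hov : EqOn g₁ g₂ (s ∩ t) := by
    have h1 : g₁ =ᵐ[μ.restrict (s ∩ t)] f := ae_restrict_of_ae_restrict_of_subset inter_subset_left hae₁
    have h2 : g₂ =ᵐ[μ.restrict (s ∩ t)] f := ae_restrict_of_ae_restrict_of_subset inter_subset_right hae₂
    exact Measure.eqOn_open_of_ae_eq (h1.trans h2.symm) (hs.inter ht) (hg₁.mono inter_subset_left) (hg₂.mono inter_subset_right)
  refine ⟨s.piecewise g₁ g₂, ?_, ?_⟩
  · -- the glued function is `g₁` on `s` and `g₂` on `t`
    have hs' : EqOn (s.piecewise g₁ g₂) g₁ s := piecewise_eqOn s g₁ g₂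
    have ht' : EqOn (s.piecewise g₁ g₂) g₂ t := by
      intro x hx
      by_cases hxs : x ∈ s
      · rw [piecewise_eq_of_mem s g₁ g₂ hxs]; exact hov ⟨hxs, hx⟩
      · exact piecewise_eq_of_notMem s g₁ g₂ hxs
    rw [(hs.union ht).continuousOn_iff]
    intro x hx
    rcases hx with hx | hx
    · exact ((hs.continuousOn_iff.1 (hg₁.congr hs')) hx)
    · exact ((ht.continuousOn_iff.1 (hg₂.congr ht')) hx)
  · -- and a.e. equal to `f` on the union
    have e₁ : ∀ᵐ x ∂μ.restrict s, s.piecewise g₁ g₂ x = f x := by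
      filter_upwards [hae₁, ae_restrict_mem hs.measurableSet] with x hx hxs
      rw [piecewise_eq_of_mem s g₁ g₂ hxs]; exact hx
    have e₂ : ∀ᵐ x ∂μ.restrict t, s.piecewise g₁ g₂ x = f x := by
      filter_upwards [hae₂, ae_restrict_mem ht.measurableSet] with x hx hxt
      by_cases hxs : x ∈ s
      · rw [piecewise_eq_of_mem s g₁ g₂ hxs, hov ⟨hxs, hxt⟩]; exact hx
      · rw [piecewise_eq_of_notMem s g₁ g₂ hxs]; exact hx
    show ∀ᵐ x ∂μ.restrict (s ∪ t), s.piecewise g₁ g₂ x = f x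
    rw [ae_restrict_union_eq]
    exact ⟨e₁, e₂⟩

/-- Three open sets covering the space: on-domain versions on each give an everywhere continuous version. [cite: Balaban1987RG1, (0.13) p.254 (bookkeeping)] -/
theorem hasContVersion_of_cover₃ [OpensMeasurableSpace α] [μ.IsOpenPosMeasure] {u : Set α} (hs : IsOpen s) (ht : IsOpen t) (hu : IsOpen u)
    (hcov : s ∪ t ∪ u = univ) (h₁ : HasContVersionOn μ f s) (h₂ : HasContVersionOn μ f t) (h₃ : HasContVersionOn μ f u) :
    HasContVersion μ f := by
  rw [← hasContVersionOn_univ_iff, ← hcov]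
  exact ((h₁.union hs ht h₂).union (hs.union ht) hu h₃)

end Generic

/-! ## §2. The kernel transform of a density VANISHES a.e. on every measurable set of coarse fields missed by the averages of its support -/

section Vanishing

variable {F : T4Family} {N : ℕ} [NeZero N]

/-- The transform of record of an integrable density is integrable (`k < K`). [cite: Balaban1988Convergent, (3.1) p.264 (kernel property of the tree's transport, by name)] -/
theorem integrable_transportOfRecord {K k : ℕ} (hk : k < K) {ρ : Density (F.P K) k (SU N)} (hρ : Integrable ρ (fieldMeasure (F.P K) k (SU N))) :
    Integrable (transportOfRecord F N K k ρ) (fieldMeasure (F.P K) (k + 1) (SU N)) :=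
  integrable_kernelTransport (fieldMeasure (F.P K) k (SU N)) (fieldMeasure (F.P K) (k + 1) (SU N)) (avOfRecord_measurable F N K k)
    (avOfRecord_haarAC F N K k hk) hρ

/-- **SUPPORT TRANSPORT (push-forward reading)**: if an integrable density `ρ` vanishes off a set `S` of fine fields whose averages of record avoid a measurable set
`E` of coarse fields, then the kernel transform of record of `ρ` is `0` for a.e. coarse field in `E` — `IsRT` ([B7] (10): `∫ (Tρ) f = ∫ ρ · f ∘ Ū`) tested
against the indicators of the measurable subsets of `E`. [cite: Balaban1985Averaging, (10) p.19; Balaban1987RG1, (0.17) p.255] -/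
theorem transportOfRecord_ae_eq_zero_of_mapsTo {K k : ℕ} (hk : k < K) {ρ : Density (F.P K) k (SU N)} (hρ : Integrable ρ (fieldMeasure (F.P K) k (SU N)))
    {S : Set (GaugeField (F.P K) k (SU N))} (hS : ∀ U, ρ U ≠ 0 → U ∈ S) {E : Set (PBond (F.P K) (k + 1) → SU N)} (hE : MeasurableSet E)
    (hSE : ∀ U ∈ S, (avOfRecord F N K k).avg U ∉ E) :
    (fun V : PBond (F.P K) (k + 1) → SU N => transportOfRecord F N K k ρ V) =ᵐ[(piHaar (F.P K) (k + 1) (SU N)).restrict E] 0 := by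
  have hint : Integrable (fun V : PBond (F.P K) (k + 1) → SU N => transportOfRecord F N K k ρ V)
      ((piHaar (F.P K) (k + 1) (SU N)).restrict E) :=
    (integrable_transportOfRecord hk hρ).restrict
  refine hint.ae_eq_zero_of_forall_setIntegral_eq_zero fun s hs _ => ?_
  have hRT := isRT_transportOfRecord F N K k hk ρ hρ
  rw [Measure.restrict_restrict hs, ← integral_indicator (hs.inter hE)]
  have hind : Measurable ((s ∩ E).indicator fun _ : PBond (F.P K) (k + 1) → SU N => (1 : ℝ)) := measurable_const.indicator (hs.inter hE)
  have hbd : ∃ C : ℝ, ∀ V, |(s ∩ E).indicator (fun _ : PBond (F.P K) (k + 1) → SU N => (1 : ℝ)) V| ≤ C :=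
    ⟨1, fun V => by by_cases hV : V ∈ s ∩ E <;> simp [hV]⟩
  have e : (fun V : PBond (F.P K) (k + 1) → SU N => (s ∩ E).indicator (fun W => transportOfRecord F N K k ρ W) V) =
      fun V : PBond (F.P K) (k + 1) → SU N => transportOfRecord F N K k ρ V * (s ∩ E).indicator (fun _ => (1 : ℝ)) V := by
    funext V; by_cases hV : V ∈ s ∩ E <;> simp [hV]
  have key : ∫ V, transportOfRecord F N K k ρ V * (s ∩ E).indicator (fun _ => (1 : ℝ)) V ∂(piHaar (F.P K) (k + 1) (SU N)) =
      ∫ U, ρ U * (s ∩ E).indicator (fun _ => (1 : ℝ)) ((avOfRecord F N K k).avg U) ∂(fieldMeasure (F.P K) k (SU N)) :=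
    hRT _ hind hbd
  rw [e, key]
  refine integral_eq_zero_of_ae (ae_of_all _ fun U => ?_)
  by_cases hU : ρ U = 0
  · simp [hU]
  · have hnot : (avOfRecord F N K k).avg U ∉ s ∩ E := fun h => hSE U (hS U hU) h.2
    have h0 : (s ∩ E).indicator (fun _ : PBond (F.P K) (k + 1) → SU N => (1 : ℝ)) ((avOfRecord F N K k).avg U) = 0 :=
      indicator_of_notMem hnot _
    exact (congrArg (fun t : ℝ => ρ U * t) h0).trans (mul_zero _)

/-- … hence it has a version continuous ON `E` (the constant `0`). [cite: Balaban1987RG1, (0.13) p.254 and (0.17) p.255 (bookkeeping)] -/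
theorem hasContTransportOn_of_mapsTo {K k : ℕ} (hk : k < K) {ρ : Density (F.P K) k (SU N)} (hρ : Integrable ρ (fieldMeasure (F.P K) k (SU N)))
    {S : Set (GaugeField (F.P K) k (SU N))} (hS : ∀ U, ρ U ≠ 0 → U ∈ S) {E : Set (PBond (F.P K) (k + 1) → SU N)} (hE : MeasurableSet E)
    (hSE : ∀ U ∈ S, (avOfRecord F N K k).avg U ∉ E) : HasContTransportOn F N K k ρ E :=
  hasContVersionOn_of_ae_eq_zero (transportOfRecord_ae_eq_zero_of_mapsTo hk hρ hS hE hSE)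

end Vanishing

/-! ## §3. The far region of coarse fields and the guard under which ε₀-small fields do not average into it ([B7] Prop 1, crude form) -/

section Far

variable (F : T4Family) (N : ℕ) [NeZero N]

/-- The crude Prop-1 constant of the torus `P`: `C = L² + 6((d+2)L)²` (`BlockAveragingPlaquetteBound.plaqSmall_blockAvg_expMeanLogSU`).
[cite: Balaban1985Averaging, Prop. 1 (51) p.26] -/
def cFar (P : Params) : ℝ := (P.L : ℝ) ^ 2 + 6 * (((P.d + 2) * P.L : ℕ) : ℝ) ^ 2

/-- **THE FAR-FIELD GUARD ON THE NUMERICS** (print's «ε₀ sufficiently small», in the tree's crude-Prop-1 form): `0 ≤ ε₀` and `(((d+2)L)²/4)·ε₀ < δ_N = min(1/3, π/N)`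
— every (0.4) loop variable of an ε₀-small field then lies in the `exp[mean log]` chart.  DISPLAYED, never asserted; it fails at `ε₀ = 1`.
[cite: Balaban1985Averaging, Prop. 1 p.26; Balaban1987RG1, Thm 3 p.264 («positive constants … ε₀»)] -/
def FarGuard (ν : Stage7Numerics) (P : Params) : Prop :=
  0 ≤ ν.ε₀ ∧ ((((P.d + 2) * P.L : ℕ) : ℝ) ^ 2 / 4) * ν.ε₀ < deltaSU (Fin N)

/-- **THE FAR REGION** of step-`k` fields of the `K`-th torus at scale factor `c`: some plaquette variable is farther than `c·ε₀` from `1` (a finite union of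
strict super-level sets, on the raw configuration type `PBond → SU(N)` with its Pi topology, as FILE 1's domains).
[cite: Balaban1987RG1, (0.17)–(0.18) p.255 (the large-field side of the split)] -/
def farRegion (ν : Stage7Numerics) (c : ℝ) (K k : ℕ) : Set (PBond (F.P K) k → SU N) :=
  ⋃ p : Plaq (F.P K) k, {V | c * ν.ε₀ < dist1 (GaugeField.plaqHol (V : GaugeField (F.P K) k (SU N)) p)}

/-- **THE TRANSITION ANNULUS** at scale factor `c`: NOT in the small-field domain, yet every plaquette variable within `c·ε₀` of `1`.
[cite: Balaban1987RG1, (0.17)–(0.18) p.255 and p.259] -/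
def annulus (ν : Stage7Numerics) (c : ℝ) (K k : ℕ) : Set (PBond (F.P K) k → SU N) :=
  {V | (V : GaugeField (F.P K) k (SU N)) ∉ domAltOfRecord F N ν K k ∧
    ∀ p : Plaq (F.P K) k, dist1 (GaugeField.plaqHol (V : GaugeField (F.P K) k (SU N)) p) ≤ c * ν.ε₀}

variable {F N}

/-- Membership in the far region. [cite: Balaban1987RG1, (0.18) p.255 (bookkeeping)] -/
theorem mem_farRegion_iff (ν : Stage7Numerics) (c : ℝ) (K k : ℕ) (V : PBond (F.P K) k → SU N) :
    V ∈ farRegion F N ν c K k ↔ ∃ p : Plaq (F.P K) k, c * ν.ε₀ < dist1 (GaugeField.plaqHol (V : GaugeField (F.P K) k (SU N)) p) := by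
  unfold farRegion; exact mem_iUnion

/-- The far region is open (finitely many strict inequalities of continuous functions). [cite: Balaban1987RG1, (0.18) p.255 (bookkeeping)] -/
theorem isOpen_farRegion (ν : Stage7Numerics) (c : ℝ) (K k : ℕ) : IsOpen (farRegion F N ν c K k) :=
  isOpen_iUnion fun p => isOpen_lt continuous_const
    ((continuous_dist1_SU (N := N)).comp (continuous_plaqHol_SU (N := N) (P := F.P K) (j := k) p))

/-- The far region is measurable. [cite: Balaban1987RG1, (0.18) p.255 (bookkeeping)] -/
theorem measurableSet_farRegion (ν : Stage7Numerics) (c : ℝ) (K k : ℕ) : MeasurableSet (farRegion F N ν c K k) :=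
  MeasurableSet.iUnion fun p => measurableSet_lt measurable_const
    (RegularGaugeGroup.measurable_dist1.comp (Missing.measurable_plaqHol (P := F.P K) (j := k) (G := SU N) p))

/-- For `c ≥ 1` and `ε₀ ≥ 0` the far region misses the small-field domain. [cite: Balaban1987RG1, (0.18) p.255 and p.259 (bookkeeping)] -/
theorem not_mem_domAlt_of_mem_farRegion (ν : Stage7Numerics) {c : ℝ} (hc : 1 ≤ c) (hε : 0 ≤ ν.ε₀) {K k : ℕ} {V : PBond (F.P K) k → SU N}
    (hV : V ∈ farRegion F N ν c K k) : (V : GaugeField (F.P K) k (SU N)) ∉ domAltOfRecord F N ν K k := by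
  intro hdom
  obtain ⟨p, hp⟩ := (mem_farRegion_iff ν c K k V).1 hV
  have hlt := (mem_domAltOfRecord_iff F N ν K k _).1 hdom p
  have : ν.ε₀ ≤ c * ν.ε₀ := le_mul_of_one_le_left hε hc
  linarith

/-- **THE THREE REGIONS COVER**: for any set `Nb` containing the annulus, `domAlt ∪ Nb ∪ far = univ` (trichotomy on the plaquette variables; no guard).
[cite: Balaban1987RG1, (0.17)–(0.18) p.255] -/
theorem domAlt_union_nbhd_union_far_eq_univ (ν : Stage7Numerics) (c : ℝ) (K k : ℕ) {Nb : Set (PBond (F.P K) k → SU N)}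
    (hNb : annulus F N ν c K k ⊆ Nb) : (domAltOfRecord F N ν K k : Set (PBond (F.P K) k → SU N)) ∪ Nb ∪ farRegion F N ν c K k = univ := by
  refine eq_univ_of_forall fun V => ?_
  by_cases hV : (V : GaugeField (F.P K) k (SU N)) ∈ domAltOfRecord F N ν K k
  · exact Or.inl (Or.inl hV)
  · by_cases hfar : ∃ p : Plaq (F.P K) k, c * ν.ε₀ < dist1 (GaugeField.plaqHol (V : GaugeField (F.P K) k (SU N)) p)
    · exact Or.inr ((mem_farRegion_iff ν c K k V).2 hfar)
    · exact Or.inl (Or.inr (hNb ⟨hV, fun p => le_of_not_gt fun h => hfar ⟨p, h⟩⟩))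

/-- `1 ≤ cFar P` (so the far region at `cFar` misses the domain whenever `ε₀ ≥ 0`). [cite: Balaban1985Averaging, Prop. 1 p.26 (bookkeeping)] -/
theorem one_le_cFar (P : Params) : 1 ≤ cFar P := by
  unfold cFar
  have hL : (1 : ℝ) ≤ P.L := by exact_mod_cast P.hL.2.le
  have h1 : (1 : ℝ) ≤ (P.L : ℝ) ^ 2 := by nlinarith
  have h2 : (0 : ℝ) ≤ 6 * (((P.d + 2) * P.L : ℕ) : ℝ) ^ 2 := by positivity
  linarith

/-- **ε₀-SMALL FINE FIELDS DO NOT AVERAGE INTO THE FAR REGION** (the tree's crude Prop 1 for the (0.4) averaging of record, `k < K`, under the guard): a field in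
`domAltOfRecord ν K k` averages to a field all of whose plaquette variables are `< cFar·ε₀` from `1`.
[cite: Balaban1985Averaging, Prop. 1 (51) p.26; Balaban1987RG1, (0.4) p.253] -/
theorem avOfRecord_not_mem_farRegion {ν : Stage7Numerics} {K k : ℕ} (hg : FarGuard N ν (F.P K)) (hk : k < K)
    {U : GaugeField (F.P K) k (SU N)} (hU : U ∈ domAltOfRecord F N ν K k) :
    (avOfRecord F N K k).avg U ∉ farRegion F N ν (cFar (F.P K)) K (k + 1) := by
  intro hfar
  obtain ⟨p, hp⟩ := (mem_farRegion_iff ν _ K (k + 1) _).1 hfar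
  have hj : k + 1 ≤ (F.P K).m + (F.P K).K := by simp only [T4Continuum.T4Family.P_K]; omega
  have hsmall := BlockAveragingPlaquetteBound.plaqSmall_blockAvg_expMeanLogSU (n := Fin N) hj hg.1
    ((mem_domAltOfRecord_iff F N ν K k U).1 hU) hg.2 p
  rw [avOfRecord_avg] at hp
  unfold cFar at hp
  exact lt_asymm hsmall hp

end Far

/-! ## §4. FREE: the transform of every χ-supported density — in particular of every (0.19) density, over ANY transport — is continuous (≡ 0) on the far region -/

section FreeFar

variable {F : T4Family} {N : ℕ} [NeZero N]

/-- **FAR-FIELD VANISHING**: under the guard, an integrable density supported in the small-field domain of step `k` has kernel transform `0` a.e. on the far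
region of step `k+1`. [cite: Balaban1987RG1, (0.17) p.255; Balaban1985Averaging, Prop. 1 p.26] -/
theorem transportOfRecord_ae_eq_zero_far {ν : Stage7Numerics} {K k : ℕ} (hg : FarGuard N ν (F.P K)) (hk : k < K) {ρ : Density (F.P K) k (SU N)}
    (hρ : Integrable ρ (fieldMeasure (F.P K) k (SU N))) (hsupp : ∀ U, ρ U ≠ 0 → U ∈ domAltOfRecord F N ν K k) :
    (fun V : PBond (F.P K) (k + 1) → SU N => transportOfRecord F N K k ρ V) =ᵐ[(piHaar (F.P K) (k + 1) (SU N)).restrict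
      (farRegion F N ν (cFar (F.P K)) K (k + 1))] 0 :=
  transportOfRecord_ae_eq_zero_of_mapsTo hk hρ hsupp (measurableSet_farRegion ν _ K (k + 1)) fun _ hU => avOfRecord_not_mem_farRegion hg hk hU

/-- The (0.19) density `χ_k·e^{−GF/g_k² + A}` (def-χ's `chiFixed7` in the χ slot, ANY action `A`) is supported in the small-field domain of record.
[cite: Balaban1987RG1, (0.19) p.255 and p.259 (bookkeeping)] -/
theorem integrand_chiFixed7_support (ν : Stage7Numerics) (K : ℕ) (g : ℕ → ℝ) (k : ℕ) (gk : ℝ) (GF A : Density (F.P K) k (SU N))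
    (U : GaugeField (F.P K) k (SU N)) (hU : integrand (chiFixed7 F N ν K g k) GF gk A U ≠ 0) : U ∈ domAltOfRecord F N ν K k := by
  by_contra h
  exact hU (by rw [integrand_apply, chiFixed7_eq_zero_of_not_mem ν K g k U h, zero_mul])

/-- **FREE CONTINUITY ON THE FAR REGION, ANY TRANSPORT FAMILY**: at torus `K`, history `g`, step `k < K`, under the guard, the kernel transform of the (0.19) density met
over a transport family `T` (integrable — e.g. `TcOfRecord`, `TcOnOfRecord ν`) has a version continuous ON the far region of step `k+1` (the constant `0`).
[cite: Balaban1987RG1, (0.17)–(0.19) p.255; Balaban1985Averaging, Prop. 1 p.26] -/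
theorem hasContTransportOn_far (T : Transport F N) {ν : Stage7Numerics} {K k : ℕ} (hg : FarGuard N ν (F.P K)) (hk : k < K) (g : ℕ → ℝ)
    (hρ : Integrable (integrand (chiFixed7 F N ν K g k) (gfOfRecord F N K k) (g k) (effActionHT F N T (chiFixed7 F N ν) K g k))
      (fieldMeasure (F.P K) k (SU N))) :
    HasContTransportOn F N K k (integrand (chiFixed7 F N ν K g k) (gfOfRecord F N K k) (g k) (effActionHT F N T (chiFixed7 F N ν) K g k))
      (farRegion F N ν (cFar (F.P K)) K (k + 1)) :=
  hasContVersionOn_of_ae_eq_zero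
    (transportOfRecord_ae_eq_zero_far hg hk hρ fun U hU => integrand_chiFixed7_support ν K g k _ _ _ U hU)

/-- … at def-T's continuous-version transport `TcOfRecord` (integrability: n09-a's compactness bound). [cite: Balaban1987RG1, (0.17)–(0.19) p.255] -/
theorem hasContTransportOn_far_TcOfRecord {ν : Stage7Numerics} {K k : ℕ} (hg : FarGuard N ν (F.P K)) (hk : k < K) (g : ℕ → ℝ) :
    HasContTransportOn F N K k
      (integrand (chiFixed7 F N ν K g k) (gfOfRecord F N K k) (g k) (effActionHT F N (TcOfRecord F N) (chiFixed7 F N ν) K g k))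
      (farRegion F N ν (cFar (F.P K)) K (k + 1)) :=
  hasContTransportOn_far (TcOfRecord F N) hg hk g (integrable_integrand_TcOfRecord ν K g k)

/-- … at the on-domain transport `TcOnOfRecord ν` (integrability: FILE 2's domination). [cite: Balaban1987RG1, (0.17)–(0.19) p.255] -/
theorem hasContTransportOn_far_TcOnOfRecord {ν : Stage7Numerics} {K k : ℕ} (hg : FarGuard N ν (F.P K)) (hk : k < K) (g : ℕ → ℝ) :
    HasContTransportOn F N K k
      (integrand (chiFixed7 F N ν K g k) (gfOfRecord F N K k) (g k) (effActionHT F N (TcOnOfRecord F N ν) (chiFixed7 F N ν) K g k))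
      (farRegion F N ν (cFar (F.P K)) K (k + 1)) :=
  hasContTransportOn_far (TcOnOfRecord F N ν) hg hk g (integrable_integrand_TcOnOfRecord ν K g hk.le)

/-- **UNDER THE EVERYWHERE PROVISO THE CONTINUOUS-VERSION TRANSFORM VANISHES IDENTICALLY ON THE FAR REGION** (pointwise, not only a.e.: determinacy on the open far
region). [cite: Balaban1987RG1, (0.13) p.254 and (0.17) p.255 (bookkeeping)] -/
theorem TcOfRecord_eqOn_zero_far {ν : Stage7Numerics} {K k : ℕ} (hg : FarGuard N ν (F.P K)) (hk : k < K) {ρ : Density (F.P K) k (SU N)}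
    (hρ : Integrable ρ (fieldMeasure (F.P K) k (SU N))) (hsupp : ∀ U, ρ U ≠ 0 → U ∈ domAltOfRecord F N ν K k) (h : HasContTransportAt F N K k ρ) :
    EqOn (fun V : PBond (F.P K) (k + 1) → SU N => TcOfRecord F N K k ρ V) 0 (farRegion F N ν (cFar (F.P K)) K (k + 1)) := by
  haveI := isOpenPosMeasure_piHaar_SUN N (F.P K) (k + 1)
  have h₁ : (fun V : PBond (F.P K) (k + 1) → SU N => TcOfRecord F N K k ρ V) =ᵐ[(piHaar (F.P K) (k + 1) (SU N)).restrict
      (farRegion F N ν (cFar (F.P K)) K (k + 1))] (fun V => transportOfRecord F N K k ρ V) :=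
    ae_restrict_of_ae (TcOfRecord_ae_eq h)
  exact eqOn_of_continuousOn_of_ae_eq (α := PBond (F.P K) (k + 1) → SU N) (isOpen_farRegion ν _ K (k + 1))
    (continuous_TcOfRecord K k ρ).continuousOn continuousOn_const (h₁.trans (transportOfRecord_ae_eq_zero_far hg hk hρ hsupp))

end FreeFar

/-! ## §5. THE RESIDUE: everywhere = on the domain + on a neighbourhood of the annulus (far is free) -/

section Residue

variable {F : T4Family} {N : ℕ} [NeZero N]

/-- **THE EVERYWHERE FIELD AT ONE DENSITY FROM ITS TWO LOCATED PARTS**: under the guard, `k < K`, an integrable density supported in the small-field domain of step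
`k` whose transform has (i) a version continuous ON the small-field domain of step `k+1` (print: [III] (ii) + chart + (0.19) identification, FILE 1 §5) and (ii) a
version continuous on SOME open set containing the transition annulus (NOT in print) has an EVERYWHERE continuous version — the far part is free (§4) and the three
open sets glue (§1). [cite: Balaban1987RG1, (0.13) p.254, (0.17)–(0.19) p.255 and p.259; Balaban1985Averaging, Prop. 1 p.26] -/
theorem hasContTransportAt_of_dom_of_annulusNbhd {ν : Stage7Numerics} {K k : ℕ} (hg : FarGuard N ν (F.P K)) (hk : k < K)
    {ρ : Density (F.P K) k (SU N)} (hρ : Integrable ρ (fieldMeasure (F.P K) k (SU N))) (hsupp : ∀ U, ρ U ≠ 0 → U ∈ domAltOfRecord F N ν K k)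
    (hdom : HasContTransportOn F N K k ρ (domAltOfRecord F N ν K (k + 1)))
    {Nb : Set (PBond (F.P K) (k + 1) → SU N)} (hNo : IsOpen Nb) (hNb : annulus F N ν (cFar (F.P K)) K (k + 1) ⊆ Nb) (hann : HasContTransportOn F N K k ρ Nb) :
    HasContTransportAt F N K k ρ :=
  haveI := isOpenPosMeasure_piHaar_SUN N (F.P K) (k + 1)
  hasContVersion_of_cover₃ (isOpen_domAltOfRecord ν K (k + 1)) hNo (isOpen_farRegion ν _ K (k + 1))
    (domAlt_union_nbhd_union_far_eq_univ ν _ K (k + 1) hNb) hdom hann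
    (hasContVersionOn_of_ae_eq_zero (transportOfRecord_ae_eq_zero_far hg hk hρ hsupp))

variable (F N)

/-- **THE LOCATED EXCESS AS A DISPLAYED PREDICATE**: along transport family `T` (def-χ's χ in the slot), at every torus, history and step `k < K`, the transform of the
(0.19) density has a version continuous on SOME open neighbourhood of the transition annulus `{V ∉ domAlt_{k+1} | ∀ p, |V(∂p) − 1| ≤ cFar·ε₀}` of step `k+1`.
Print demands nothing there (`χ_{k+1} = 0` off the domain; large fields are the 𝐑-operation's); a fibre-regularity statement about (0.4).  DISPLAYED, never asserted.
[cite: Balaban1987RG1, (0.17)–(0.19) p.255 and p.259] -/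
def Stage8Params.HasContTransportAlongAnnulus (θ : Stage8Params F N) (T : Transport F N) : Prop :=
  ∀ (K : ℕ) (g : ℕ → ℝ) (k : ℕ), k < K → ∃ Nb : Set (PBond (F.P K) (k + 1) → SU N), IsOpen Nb ∧ annulus F N θ.ν (cFar (F.P K)) K (k + 1) ⊆ Nb ∧
    HasContTransportOn F N K k (integrand (chiFixed7 F N θ.ν K g k) (gfOfRecord F N K k) (g k) (effActionHT F N T (chiFixed7 F N θ.ν) K g k)) Nb

variable {F N}

/-- The everywhere field implies the annulus proviso (take `Nb := univ`). [cite: Balaban1987RG1, (0.13) p.254 (bookkeeping)] -/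
theorem Stage8Params.HasContTransportAlong.annulus {θ : Stage8Params F N} (h : θ.HasContTransportAlong) :
    θ.HasContTransportAlongAnnulus F N (TcOfRecord F N) :=
  fun K g k hk => ⟨univ, isOpen_univ, subset_univ _, (h K g k hk).on _⟩

/-- **THE RECORD'S EVERYWHERE FIELD = PRINT'S ON-DOMAIN PROVISO ∧ THE ANNULUS PROVISO** (numerics meeting the far-field guard on every torus of the family): the
exact decomposition of `Provisos₁₀.contT` into its print-located part (FILE 1's `HasContTransportAlongDom`, [I] p. 259 ∕ [III] (ii)) and its located excess.
[cite: Balaban1987RG1, (0.13) p.254, (0.17)–(0.19) p.255 and p.259; Balaban1985Averaging, Prop. 1 p.26] -/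
theorem hasContTransportAlong_iff_dom_and_annulus {θ : Stage8Params F N} (hg : ∀ K, FarGuard N θ.ν (F.P K)) :
    θ.HasContTransportAlong ↔ θ.HasContTransportAlongDom F N (TcOfRecord F N) ∧ θ.HasContTransportAlongAnnulus F N (TcOfRecord F N) := by
  refine ⟨fun h => ⟨h.dom, h.annulus⟩, fun ⟨hdom, hann⟩ K g k hk => ?_⟩
  obtain ⟨Nb, hNo, hNb, hN⟩ := hann K g k hk
  exact hasContTransportAt_of_dom_of_annulusNbhd (hg K) hk (integrable_integrand_TcOfRecord θ.ν K g k)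
    (fun U hU => integrand_chiFixed7_support θ.ν K g k _ _ _ U hU) (hdom K g k hk) hNo hNb hN

omit [NeZero N] in
/-- The guard is ONE condition on `(L, ε₀)` of the family: it does not depend on the torus index (`(F.P K).d = 4`, `(F.P K).L = F.L`).
[cite: Balaban1985Averaging, Prop. 1 p.26 (bookkeeping)] -/
theorem farGuard_iff_zero (ν : Stage7Numerics) (K : ℕ) : FarGuard N ν (F.P K) ↔ FarGuard N ν (F.P 0) := by
  unfold FarGuard
  simp only [T4Continuum.T4Family.P_d, T4Continuum.T4Family.P_L]

end Residue

/-! ## §6. THE WINDOWED ON-DOMAIN PROVISO (what [III] (ii) locates: histories in the coupling window only) and N09's inputs from it -/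

section Window

variable (F : T4Family) (N : ℕ) [NeZero N]

/-- **THE WINDOWED PRINT-SHAPED PROVISO** over the on-domain transport: as FILE 2's `ContTOnDom`, but only for histories `g` in the coupling window up to the step,
`Step.InInterval θ.γ k g` (`0 < g_j ≤ γ`, `j ≤ k` — the guard `Provisos₁₂.bg` carries).  [III] (2.27)(ii) ∕ (2.30) ∕ (2.41)(ii) speak for such histories only
(FILE 1 §4 binder `hwin`).  DISPLAYED, never asserted. [cite: Balaban1987RG1, (0.19) p.255, p.259 and Thm 3 p.264; Balaban1988Convergent, (2.27) p.259] -/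
def Stage8Params.ContTOnDomW (θ : Stage8Params F N) : Prop :=
  ∀ (K : ℕ) (g : ℕ → ℝ) (k : ℕ), k < K → Step.InInterval θ.γ k g →
    HasContTransportOn F N K k
      (integrand (chiFixed7 F N θ.ν K g k) (gfOfRecord F N K k) (g k) (effActionHT F N (TcOnOfRecord F N θ.ν) (chiFixed7 F N θ.ν) K g k))
      (domAltOfRecord F N θ.ν K (k + 1))

variable {F N}

/-- The unwindowed proviso implies the windowed one. [cite: Balaban1987RG1, (0.19) p.255 (bookkeeping)] -/
theorem Stage8Params.ContTOnDom.windowed {θ : Stage8Params F N} (h : θ.ContTOnDom F N) : θ.ContTOnDomW F N :=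
  fun K g k hk _ => h K g k hk

/-- … and so does the record's everywhere field at admissible numerics (`0 < ε₀`; FILE 2's projection, then restriction). [cite: Balaban1987RG1, (0.13) p.254 (bookkeeping)] -/
theorem contTOnDomW_of_hasContTransportAlong {θ : Stage8Params F N} (hε : 0 < θ.ν.ε₀) (h : θ.HasContTransportAlong) : θ.ContTOnDomW F N :=
  (contTOnDom_of_hasContTransportAlong hε h).windowed

/-- A window up to `n` restricts to every earlier step. [cite: Balaban1987RG1, Thm 1 p.259 (bookkeeping)] -/
theorem inInterval_of_le {γ : ℝ} {n k : ℕ} {g : ℕ → ℝ} (h : Step.InInterval γ n g) (hk : k ≤ n) : Step.InInterval γ k g :=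
  fun j hj => h j (hj.trans hk)

/-- **N09's PER-STEP TRIPLE AT A WINDOWED HISTORY FROM THE WINDOWED PROVISO**: for a history in the window up to `n ≤ K`, at every step `j < n` the image under
`TcOnOfRecord θ.ν` of the (0.19) density met is an `IsRT` image (unconditional), integrable (unconditional) and continuous ON `domAltOfRecord θ.ν K (j+1)`.
[cite: Balaban1987RG1, (0.13) p.254, (0.19) p.255, p.259 and p.263] -/
theorem stepsOn_TcOnOfRecord_of_window {θ : Stage8Params F N} (h : θ.ContTOnDomW F N) (K : ℕ) (g : ℕ → ℝ) {n : ℕ} (hn : n ≤ K)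
    (hw : Step.InInterval θ.γ n g) :
    ∀ j < n,
      IsRT (avOfRecord F N K j).avg
          (integrand (chiFixed7 F N θ.ν K g j) (gfOfRecord F N K j) (g j) (effActionHT F N (TcOnOfRecord F N θ.ν) (chiFixed7 F N θ.ν) K g j))
          (TcOnOfRecord F N θ.ν K j
            (integrand (chiFixed7 F N θ.ν K g j) (gfOfRecord F N K j) (g j) (effActionHT F N (TcOnOfRecord F N θ.ν) (chiFixed7 F N θ.ν) K g j))) ∧
        Integrable (TcOnOfRecord F N θ.ν K j
            (integrand (chiFixed7 F N θ.ν K g j) (gfOfRecord F N K j) (g j) (effActionHT F N (TcOnOfRecord F N θ.ν) (chiFixed7 F N θ.ν) K g j)))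
          (fieldMeasure (F.P K) (j + 1) (SU N)) ∧
        ContinuousOn (TcOnOfRecord F N θ.ν K j
            (integrand (chiFixed7 F N θ.ν K g j) (gfOfRecord F N K j) (g j) (effActionHT F N (TcOnOfRecord F N θ.ν) (chiFixed7 F N θ.ν) K g j)))
          (domAltOfRecord F N θ.ν K (j + 1)) :=
  fun j hj =>
    have hjK : j < K := lt_of_lt_of_le hj hn
    ⟨isRT_TcOnOfRecord_beta θ.ν K g hjK, integrable_TcOnOfRecord θ.ν hjK (integrable_integrand_TcOnOfRecord θ.ν K g hjK.le),
      continuousOn_TcOnOfRecord θ.ν (h K g j hjK (inInterval_of_le hw hj.le))⟩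

/-- **N09's COMPOSITION INPUT OVER THE ON-DOMAIN TRANSPORT FROM THE WINDOWED PROVISO** at a windowed history (+ the [B11] binders and the nesting, displayed as in
FILE 2's `hCompT_TcOnOfRecord_of_contTOnDom`). [cite: Balaban1987RG1, (1.1)–(1.3) p.260, p.263 and Thm 3 p.264; Balaban1985Variational, Thm 1 p.279] -/
theorem hCompT_TcOnOfRecord_of_contTOnDomW {θ : Stage8Params F N} (h : θ.ContTOnDomW F N) {ε : ℝ} (K : ℕ) (g : ℕ → ℝ) {n : ℕ} (hn : n ≤ K)
    (hw : Step.InInterval θ.γ n g) {k : ℕ} (hk : k ≤ n) {dom : Set (GaugeField (F.P K) k (SU N))} (hres : HRestrict F N ε K k dom)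
    (huniq : ∀ V ∈ dom, ∀ j < k, UniqueUkOrbit F N K (j + 1) ε (Averaging.iter (avOfRecord F N K) (j + 1) (Uk F N K k ε V)))
    (hnest : ∀ V ∈ dom, ∀ j < k, Averaging.iter (avOfRecord F N K) j (Uk F N K k ε V) ∈ domAltOfRecord F N θ.ν K j) :
    HCompT F N (TcOnOfRecord F N θ.ν) (chiFixed7 F N θ.ν) ε K g k dom :=
  hCompT_of_stepsOn_chiFixed7 (TcOnOfRecord F N θ.ν) θ.ν K g hn (stepsOn_TcOnOfRecord_of_window h K g hn hw) hk hres huniq hnest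

end Window

/-! ## §7. The provisos in print's push-forward currency ([B7] (10)): «ρ has a continuous renormalisation transform» -/

section PrintCurrency

variable {F : T4Family} {N : ℕ} [NeZero N]

/-- **THE EVERYWHERE PROVISO IN PRINT'S CURRENCY**: for an integrable density and `k < K`, the transform of record has an everywhere continuous version IFF `ρ` has SOME
continuous renormalisation transform in the push-forward sense `Setup.IsRT` (`∫ ρ' f = ∫ ρ · f∘Ū` for bounded measurable `f`) — two integrable `IsRT` images agree
a.e. (`T4Spectator.ae_eq_of_isRT_of_isRT`). [cite: Balaban1985Averaging, (10) p.19; Balaban1987RG1, (0.13) p.254] -/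
theorem hasContTransportAt_iff_exists_continuous_isRT {K k : ℕ} (hk : k < K) {ρ : Density (F.P K) k (SU N)}
    (hρ : Integrable ρ (fieldMeasure (F.P K) k (SU N))) :
    HasContTransportAt F N K k ρ ↔ ∃ ρ' : Density (F.P K) (k + 1) (SU N), Continuous ρ' ∧ IsRT (avOfRecord F N K k).avg ρ ρ' := by
  constructor
  · intro h
    exact ⟨TcOfRecord F N K k ρ, continuous_TcOfRecord K k ρ, isRT_TcOfRecord hk hρ h⟩
  · rintro ⟨ρ', hcont, hRT⟩
    exact ⟨ρ', hcont, ae_eq_of_isRT_of_isRT hRT (isRT_transportOfRecord F N K k hk ρ hρ) (integrable_of_continuous hcont)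
      (integrable_transportOfRecord hk hρ)⟩

/-- **THE ON-DOMAIN PROVISO IN PRINT'S CURRENCY**: for an integrable density, `k < K` and any set `s` of coarse fields, the transform of record has a version
continuous ON `s` IFF `ρ` has some INTEGRABLE renormalisation transform (`IsRT`) continuous on `s` (⇒: FILE 2's `transportCOn`). [cite: Balaban1985Averaging, (10) p.19; Balaban1987RG1, (0.13) p.254 and p.259] -/
theorem hasContTransportOn_iff_exists_continuousOn_isRT {K k : ℕ} (hk : k < K) {ρ : Density (F.P K) k (SU N)}
    (hρ : Integrable ρ (fieldMeasure (F.P K) k (SU N))) (s : Set (PBond (F.P K) (k + 1) → SU N)) :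
    HasContTransportOn F N K k ρ s ↔
      ∃ ρ' : Density (F.P K) (k + 1) (SU N), ContinuousOn ρ' s ∧ Integrable ρ' (fieldMeasure (F.P K) (k + 1) (SU N)) ∧ IsRT (avOfRecord F N K k).avg ρ ρ' := by
  constructor
  · intro h
    exact ⟨transportCOn (avOfRecord F N K k).avg ρ s, continuousOn_transportCOn h,
      integrable_transportCOn (avOfRecord_measurable F N K k) (avOfRecord_haarAC F N K k hk) hρ s,
      isRT_transportCOn (avOfRecord_measurable F N K k) (avOfRecord_haarAC F N K k hk) hρ s⟩
  · rintro ⟨ρ', hcont, hint, hRT⟩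
    exact ⟨ρ', hcont, ae_restrict_of_ae (ae_eq_of_isRT_of_isRT hRT (isRT_transportOfRecord F N K k hk ρ hρ) hint (integrable_transportOfRecord hk hρ))⟩

end PrintCurrency

end Literature.MathematicalPhysics.QuantumFieldTheory.Balaban1983to89.Node00

end
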